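import Summits.AnomalousDissipation.AnomalousDissipation.Theorems.TwodBoundedEnergyZeroMomentum.Negative.ShellPincerSpectral

/-!
# The single-shell pincer for every Leray–Hopf solution, II: the Galerkin scheme and its limit
(negative-side support for the crux `TwoAndHalfD.TwodBoundedEnergyZeroMomentum`, cdisprove seat
`refuter-cdisprove-stmt-AnomalousDissipation-10786-g2-0`, gen 2, cycle 2)

`exists_lerayHopf_shellPincer`: for a smooth steady force `g` with Fourier support on ONE shell
`|k|² = m`, `m > 0`, viscosity `ν > 0` and ANY weakly divergence-free datum `u₀ ∈ L²(𝕋²)` (no mean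
condition), there is a global Leray–Hopf solution `u` with
`‖∇u(t)‖₂² ≤ 4π²m ‖u(t)‖₂² + K e^{-8π²mν(t-1)}` for every `t ≥ 1`.
Proof: run the tree's Fourier–Galerkin scheme with the exact (band-limited) force; along each
Galerkin trajectory the signed shell excess `ξ = ‖∇U‖² - 4π²m|U|²` decays,
`ξ(t) ≤ ξ(s)e^{-8π²mν(t-s)}` (`galerkin_shellExcess_le_mul_exp`, Tran–Shepherd 2002 §4,
Constantin–Tarfulea–Vicol 2013 §2 (diffeq)); the energy identity bounds `∫₀¹‖∇U‖²` uniformly in the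
order, so some `s ∈ (0,1)` has `ξ(s) ≤ ‖∇U(s)‖² ≤ C₁ + 1`, whence `ξ(t) ≤ (C₁+1)e^{-c(t-1)}` for
`t ≥ 1` uniformly in the order; at a FIXED time the bound passes to the coefficientwise limit because
`ξ = Φ⁺ - Φ⁻` with `Φ⁺` lower semicontinuous (Fatou) and `Φ⁻` a finite sum (sibling
`ShellPincerSpectral`).  The transfer to EVERY Leray–Hopf solution (2-D uniqueness) and the
long-time consequences are in the sibling `ShellPincer`.
-/

noncomputable section

open MeasureTheory Set Filter Topology UnitAddTorus
open scoped ENNReal NNReal InnerProductSpace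

namespace Summit.AnomalousDissipation.AnomalousDissipation.Theorems.TwodBoundedEnergyZeroMomentum.Negative

open Literature.Analysis.FunctionSpaces Literature.Analysis.FunctionSpaces.Torus
open Literature.Analysis.FluidPDE Literature.Analysis.FluidPDE.Torus
open Literature.Barriers.AnomalousDissipation

section PincerGalerkin

set_option maxHeartbeats 400000 in
/-- **The single-shell pincer along the Galerkin scheme, and its Leray–Hopf limit** (Tran–Shepherd
2002 §4; Constantin–Tarfulea–Vicol 2013 §2 (diffeq)–(enst), here for `L²` data, the transient
`δ₊(0)` of the printed argument being replaced by the decaying `K e^{-8π²mν(t-1)}`). For a smooth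
force supported on the shell `|k|² = m > 0`, `ν > 0`, and a weakly divergence-free `u₀ ∈ L²`, there
is a global Leray–Hopf solution `u` with `‖∇u(t)‖₂² ≤ 4π²m‖u(t)‖₂² + K e^{-8π²mν(t-1)}`, `t ≥ 1`. [cite: ConstantinTarfuleaVicol2013, §2 (diffeq)–(enst)] -/
theorem exists_lerayHopf_shellPincer {g : (UnitAddTorus (Fin 2)) → (EuclideanSpace ℝ (Fin 2))}
    (hg : IsSmooth g) {m : ℝ} (hm : 0 < m)
    (hg1 : ∀ k : (Fin 2 → ℤ), freqNormSq k ≠ m → mFourierCoeff (EuclideanSpace.complexify ∘ g) k = 0)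
    {ν : ℝ} (hν : 0 < ν) {u₀ : (UnitAddTorus (Fin 2)) → (EuclideanSpace ℝ (Fin 2))} (hu₀ : MemLp u₀ 2 volume)
    (hdiv : IsWeaklyDivFree u₀) :
    ∃ u : ℝ → (UnitAddTorus (Fin 2)) → (EuclideanSpace ℝ (Fin 2)), IsGlobalLerayHopf ν (fun _ => g) u₀ u ∧
      ∃ K : ℝ, 0 ≤ K ∧ ∀ t, 1 ≤ t →
        eGradNormSq (u t) ≤ ENNReal.ofReal (4 * Real.pi ^ 2 * m * (∫ x, ‖u t x‖ ^ 2) +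
          K * Real.exp (-(8 * Real.pi ^ 2 * m * ν) * (t - 1))) := by
  classical
  -- the force and its coefficients
  set f : (UnitAddTorus (Fin 2)) → (EuclideanSpace ℝ (Fin 2)) := g with hf_def
  have hf_smooth : IsSmooth f := hg
  have hf_int : Integrable f volume := hf_smooth.integrable
  have hfm : AEStronglyMeasurable (stLift fun _ : ℝ => f) (volume.restrict (Ioi 0 ×ˢ univ)) :=
    aestronglyMeasurable_stLift_steady hf_smooth.continuous _
  have hf₂ : ∀ T : ℝ, 0 < T → ∫⁻ _ in Ioo 0 T, ∫⁻ x, ‖f x‖ₑ ^ 2 < ⊤ := fun T _ =>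
    lintegral_Ioo_lintegral_enorm_sq_steady_lt_top (hf_smooth.memLp 2) T
  set fhat : (Fin 2 → ℤ) → (EuclideanSpace ℂ (Fin 2)) := fun k => mFourierCoeff (EuclideanSpace.complexify ∘ f) k with hfhat
  set uhat₀ : (Fin 2 → ℤ) → (EuclideanSpace ℂ (Fin 2)) := fun k => mFourierCoeff (EuclideanSpace.complexify ∘ u₀) k with huhat₀
  have hu₀_int : Integrable u₀ volume := hu₀.integrable one_le_two
  -- the band of the force and the frequency sets `S n = freqBall (n + N₀)`
  set N₀ : ℕ := ⌈m⌉₊ + 1 with hN₀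
  have hN₀1 : 1 ≤ N₀ := Nat.le_add_left 1 _
  have hmN₀ : m ≤ (N₀ : ℝ) := by
    have h1 : m ≤ (⌈m⌉₊ : ℝ) := Nat.le_ceil m
    have h2 : ((⌈m⌉₊ : ℕ) : ℝ) ≤ ((⌈m⌉₊ + 1 : ℕ) : ℝ) := by exact_mod_cast Nat.le_succ _
    exact h1.trans h2
  set S : ℕ → Finset (Fin 2 → ℤ) := fun n => freqBall (n + N₀) with hS_def
  have hS : ∀ n, ∀ k ∈ S n, -k ∈ S n := fun n => neg_mem_freqBall_of_mem
  have h0S : ∀ n, (0 : (Fin 2 → ℤ)) ∈ S n := fun n => zero_mem_freqBall _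
  -- force and data coefficient vectors
  set gc : (n : ℕ) → ↥(S n) → (EuclideanSpace ℂ (Fin 2)) := fun n k => fhat k with hgc
  set c₀ : (n : ℕ) → ↥(S n) → (EuclideanSpace ℂ (Fin 2)) := fun n k => uhat₀ k with hc₀
  have hg_real : ∀ n, IsRealCoeff (gc n) := fun n => isRealCoeff_mFourierCoeff hf_int
  have hc₀_mem : ∀ n, c₀ n ∈ galerkinSubspace (S n) := fun n =>
    ⟨isRealCoeff_mFourierCoeff hu₀_int, isSolenoidalCoeff_restrict (hdiv.isTransversal_mFourierCoeff hu₀ (S n))⟩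
  have hg1' : ∀ n (k : ↥(S n)), freqNormSq (k : (Fin 2 → ℤ)) ≠ m → gc n k = 0 := fun n k hk =>
    hg1 k hk
  -- the global Galerkin solutions
  have hsol : ∀ n : ℕ, ∃ β : ℝ → ↥(S n) → (EuclideanSpace ℂ (Fin 2)), β 0 = c₀ n ∧ (∀ t, β t ∈ galerkinSubspace (S n)) ∧
      ContinuousOn β (Ici 0) ∧
      ∀ T, ∀ t ∈ Icc 0 T, HasDerivWithinAt β (galerkinRHS (S n) ν (gc n) (β t)) (Icc 0 T) t :=
    fun n => exists_galerkin_solution ν hν.le (hS n) (g := fun _ => gc n) continuous_const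
      (fun _ => hg_real n) (hc₀_mem n)
  choose β hβ0 hβmem hβcont hβderiv using hsol
  -- the fields
  set F : ℕ → ℝ → (UnitAddTorus (Fin 2)) → (EuclideanSpace ℝ (Fin 2)) := fun n _ => realTrigPoly (S n) (coeffExt (S n) (gc n)) with hF
  set U : ℕ → ℝ → (UnitAddTorus (Fin 2)) → (EuclideanSpace ℝ (Fin 2)) := fun n t => realTrigPoly (S n) (coeffExt (S n) (β n t)) with hU
  have hFf : ∀ n t, F n t = f := by
    intro n t
    show realTrigPoly (S n) (coeffExt (S n) fun k : ↥(S n) => fhat k) = f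
    rw [realTrigPoly_coeffExt_restrict, hfhat, ← fourierTruncate_eq]
    refine fourierTruncate_eq_self hf_smooth.continuous fun k hk => hg1 k ?_
    have h1 : m ≤ ((n + N₀ : ℕ) : ℝ) ^ 2 := by
      have h2 : (N₀ : ℝ) ≤ ((n + N₀ : ℕ) : ℝ) := by exact_mod_cast Nat.le_add_left N₀ n
      have h3 : (1 : ℝ) ≤ ((n + N₀ : ℕ) : ℝ) := by exact_mod_cast le_trans hN₀1 (Nat.le_add_left N₀ n)
      nlinarith
    exact ne_of_gt (h1.trans_lt hk)
  have hU0 : ∀ n, U n 0 = fourierTruncate (n + N₀) u₀ := by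
    intro n
    show realTrigPoly (S n) (coeffExt (S n) (β n 0)) = _
    rw [hβ0 n, fourierTruncate_eq]
    exact realTrigPoly_coeffExt_restrict _
  have hband : ∀ {n : ℕ} {b : (UnitAddTorus (Fin 2)) → (EuclideanSpace ℝ (Fin 2))}, IsGalerkinMode (n + N₀) b →
      ∀ k ∉ S n, mFourierCoeff (EuclideanSpace.complexify ∘ b) k = 0 :=
    fun hb k hk => hb.mFourierCoeff_eq_zero (not_mem_freqBall.1 hk)
  -- the scheme
  have hScheme : IsHopfGalerkinScheme ν (fun _ => f) u₀ (fun n => n + N₀) F U :=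
    { tendsto_order := tendsto_add_atTop_nat N₀
      smooth_force := fun n => contDiff_stLift_realTrigPoly (g := fun _ : ℝ => gc n) contDiff_const
      tendsto_force := fun T _ => by
        have h0 : (fun n => ∫⁻ t in Ioo 0 T, ∫⁻ x, ‖F n t x - f x‖ₑ ^ 2) = fun _ => 0 := by
          funext n
          simp only [hFf, sub_self, enorm_zero, ne_eq, OfNat.ofNat_ne_zero, not_false_eq_true,
            zero_pow, lintegral_zero]
        rw [h0]
        exact tendsto_const_nhds
      continuousOn := fun n => continuousOn_stLift_realTrigPoly (hβcont n)
      isGalerkinMode := fun n t _ =>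
        have h := galerkin_slice_props (hS n) (hβmem n t)
        ⟨h.1, h.2.1, fun k hk => h.2.2.2 k (not_mem_freqBall.2 hk)⟩
      isWeaklyDivFree := fun n t _ => (galerkin_slice_props (hS n) (hβmem n t)).2.2.1
      galerkin := fun n b hb s t hs hst =>
        galerkin_test_identity ν (hS n) (g := fun _ => gc n) continuous_const (fun _ => hg_real n)
          (hβmem n) (hβderiv n) hb.isSmooth hb.isDivFree (hband hb) hs hst
      energy_eq := fun n s t hs hst =>
        galerkin_energy_identity ν (hS n) (g := fun _ => gc n) continuous_const (fun _ => hg_real n)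
          (hβmem n) (hβderiv n) hs hst
      initial_inner := fun n b hb => by
        rw [hU0 n]
        exact integral_inner_fourierTruncate_eq hu₀ (hb.isSmooth.memLp 2) (hband hb)
      tendsto_initial := by
        have heq : (fun n => eLpNorm (U n 0 - u₀) 2 volume) =
            fun n => eLpNorm (fourierTruncate (n + N₀) u₀ - u₀) 2 volume := by
          funext n; rw [hU0 n]
        rw [heq]
        exact (tendsto_eLpNorm_fourierTruncate_sub hu₀).comp (tendsto_add_atTop_nat N₀) }
  -- the limit field and the global Leray–Hopf solution
  obtain ⟨φ, hφ, u, hum, hu, hc⟩ := hScheme.exists_limitField hν.le hu₀ hfm hf₂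
  have hLH : IsGlobalLerayHopf ν (fun _ => f) u₀ u := fun T hT =>
    (hScheme.comp_strictMono hφ).isLerayHopfOn_limit hν hu₀ hdiv hfm hf₂ hum hu hc hT
  -- Fourier coefficients of the Galerkin states
  have hcoefU : ∀ n t k, mFourierCoeff (EuclideanSpace.complexify ∘ U n t) k = coeffExt (S n) (β n t) k :=
    fun n t k => mFourierCoeff_realTrigPoly_coeffExt (hS n) (hβmem n t).1 k
  -- the force bound on `(0, 1)` and the dissipation constant
  obtain ⟨A, hA, hFA⟩ := hScheme.exists_force_bound hfm hf₂ one_pos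
  set E0 : ℝ := ∫ x, ‖u₀ x‖ ^ 2 with hE0
  set C₁ : ℝ := (E0 + 2 * 1 * A.toReal) / ν with hC₁
  have hE00 : 0 ≤ E0 := integral_nonneg fun _ => sq_nonneg _
  have hC₁0 : 0 ≤ C₁ := by positivity
  set K₁ : ℝ := C₁ + 1 with hK₁
  have hK₁0 : 0 ≤ K₁ := by positivity
  set cc : ℝ := 8 * Real.pi ^ 2 * m * ν with hcc
  have hcc0 : 0 ≤ cc := by positivity
  -- Galerkin enstrophy and signed excess
  set Z : ℕ → ℝ → ℝ := fun n s => 4 * Real.pi ^ 2 * ∑ k : ↥(S n), freqNormSq (k : Fin 2 → ℤ) * ‖β n s k‖ ^ 2 with hZ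
  set ξ : ℕ → ℝ → ℝ := fun n s => ∑ k : ↥(S n), (4 * Real.pi ^ 2 * (freqNormSq (k : Fin 2 → ℤ) - m)) * ‖β n s k‖ ^ 2 with hξ
  have hZ_eGrad : ∀ n s, eGradNormSq (U n s) = ENNReal.ofReal (Z n s) := fun n s =>
    eGradNormSq_coeffExt (hS n) (hβmem n s).1
  have hξ_le_Z : ∀ n s, ξ n s ≤ Z n s := by
    intro n s
    simp only [hξ, hZ, Finset.mul_sum]
    refine Finset.sum_le_sum fun k _ => ?_
    have h1 : 0 ≤ 4 * Real.pi ^ 2 * m * ‖β n s k‖ ^ 2 := by positivity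
    have h2 : (4 * Real.pi ^ 2 * (freqNormSq (k : Fin 2 → ℤ) - m)) * ‖β n s k‖ ^ 2 =
        4 * Real.pi ^ 2 * (freqNormSq (k : Fin 2 → ℤ) * ‖β n s k‖ ^ 2) - 4 * Real.pi ^ 2 * m * ‖β n s k‖ ^ 2 := by
      ring
    rw [h2]
    linarith
  -- STEP 1: a good time `s_n ∈ (0,1)` with `Z n s_n ≤ C₁ + 1`
  have hgood : ∀ n, ∃ s ∈ Ioo (0 : ℝ) 1, Z n s ≤ K₁ := by
    intro n
    by_contra hcon
    push Not at hcon
    have hdiss := hScheme.lintegral_eGradNormSq_le hν hu₀ one_pos hA n (hFA n)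
    have hlow : ENNReal.ofReal K₁ * volume (Ioo (0 : ℝ) 1) ≤ ∫⁻ t in Ioo 0 1, eGradNormSq (U n t) := by
      rw [← setLIntegral_const]
      refine setLIntegral_mono' measurableSet_Ioo fun t ht => ?_
      rw [hZ_eGrad]
      exact ENNReal.ofReal_le_ofReal (hcon t ht).le
    rw [Real.volume_Ioo, sub_zero, ENNReal.ofReal_one, mul_one] at hlow
    have h := hlow.trans hdiss
    rw [ENNReal.ofReal_le_ofReal_iff hC₁0] at h
    simp only [hK₁] at h
    linarith
  choose sgood hsgood_mem hsgood using hgood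
  -- STEP 2: the decaying bound on the signed excess for `t ≥ 1`
  have hξ_bound : ∀ n t, 1 ≤ t → ξ n t ≤ K₁ * Real.exp (-cc * (t - 1)) := by
    intro n t ht
    have hs0 : 0 ≤ sgood n := (hsgood_mem n).1.le
    have hs1 : sgood n ≤ 1 := (hsgood_mem n).2.le
    have hdecay := galerkin_shellExcess_le_mul_exp hν.le (hS n) (hβmem n) (hβderiv n) m (hg1' n) hs0
      (hs1.trans ht)
    have hexp1 : Real.exp (-(8 * Real.pi ^ 2 * m * ν) * (t - sgood n)) ≤ Real.exp (-cc * (t - 1)) := by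
      refine Real.exp_le_exp.2 ?_
      simp only [hcc]
      nlinarith
    have hexp0 : 0 ≤ Real.exp (-(8 * Real.pi ^ 2 * m * ν) * (t - sgood n)) := (Real.exp_pos _).le
    rcases le_or_gt 0 (ξ n (sgood n)) with hpos | hneg
    · calc ξ n t ≤ ξ n (sgood n) * Real.exp (-(8 * Real.pi ^ 2 * m * ν) * (t - sgood n)) := hdecay
        _ ≤ K₁ * Real.exp (-cc * (t - 1)) := by
            refine mul_le_mul ((hξ_le_Z n _).trans (hsgood n)) hexp1 hexp0 hK₁0
    · calc ξ n t ≤ ξ n (sgood n) * Real.exp (-(8 * Real.pi ^ 2 * m * ν) * (t - sgood n)) := hdecay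
        _ ≤ 0 := mul_nonpos_of_nonpos_of_nonneg hneg.le hexp0
        _ ≤ K₁ * Real.exp (-cc * (t - 1)) := by positivity
  -- STEP 3: the same bound for the clipped series of the Galerkin states, in `ℝ≥0∞`
  have hPlus_le : ∀ n t, 1 ≤ t →
      (∑' k : Fin 2 → ℤ, ENNReal.ofReal (4 * Real.pi ^ 2 * (freqNormSq k - m)) *
          ‖mFourierCoeff (EuclideanSpace.complexify ∘ U n t) k‖ₑ ^ 2) ≤
        (∑' k : Fin 2 → ℤ, ENNReal.ofReal (4 * Real.pi ^ 2 * (m - freqNormSq k)) *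
          ‖mFourierCoeff (EuclideanSpace.complexify ∘ U n t) k‖ₑ ^ 2) +
          ENNReal.ofReal (K₁ * Real.exp (-cc * (t - 1))) := by
    intro n t ht
    simp_rw [hcoefU]
    exact shellPlus_le_of_excess_le m (β n t) (by positivity) (hξ_bound n t ht)
  -- the limit field and the global Leray–Hopf solution
  obtain ⟨φ, hφ, u, hum, hu, hc⟩ := hScheme.exists_limitField hν.le hu₀ hfm hf₂
  have hLH : IsGlobalLerayHopf ν (fun _ => f) u₀ u := fun T hT =>
    (hScheme.comp_strictMono hφ).isLerayHopfOn_limit hν hu₀ hdiv hfm hf₂ hum hu hc hT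
  -- Fourier coefficients of the Galerkin states
  have hcoefU : ∀ n t k, mFourierCoeff (EuclideanSpace.complexify ∘ U n t) k = coeffExt (S n) (β n t) k :=
    fun n t k => mFourierCoeff_realTrigPoly_coeffExt (hS n) (hβmem n t).1 k
  -- the force bound on `(0, 1)` and the dissipation constant
  obtain ⟨A, hA, hFA⟩ := hScheme.exists_force_bound hfm hf₂ one_pos
  set E0 : ℝ := ∫ x, ‖u₀ x‖ ^ 2 with hE0
  set C₁ : ℝ := (E0 + 2 * 1 * A.toReal) / ν with hC₁
  have hE00 : 0 ≤ E0 := integral_nonneg fun _ => sq_nonneg _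
  have hC₁0 : 0 ≤ C₁ := by positivity
  set K₁ : ℝ := C₁ + 1 with hK₁
  have hK₁0 : 0 ≤ K₁ := by positivity
  set cc : ℝ := 8 * Real.pi ^ 2 * m * ν with hcc
  have hcc0 : 0 ≤ cc := by positivity
  -- Galerkin enstrophy and signed excess
  set Z : ℕ → ℝ → ℝ := fun n s => 4 * Real.pi ^ 2 * ∑ k : ↥(S n), freqNormSq (k : Fin 2 → ℤ) * ‖β n s k‖ ^ 2 with hZ
  set ξ : ℕ → ℝ → ℝ := fun n s => ∑ k : ↥(S n), (4 * Real.pi ^ 2 * (freqNormSq (k : Fin 2 → ℤ) - m)) * ‖β n s k‖ ^ 2 with hξ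
  have hZ_eGrad : ∀ n s, eGradNormSq (U n s) = ENNReal.ofReal (Z n s) := fun n s =>
    eGradNormSq_coeffExt (hS n) (hβmem n s).1
  have hξ_le_Z : ∀ n s, ξ n s ≤ Z n s := by
    intro n s
    simp only [hξ, hZ, Finset.mul_sum]
    refine Finset.sum_le_sum fun k _ => ?_
    have h1 : 0 ≤ ‖β n s k‖ ^ 2 := sq_nonneg _
    nlinarith [freqNormSq_nonneg (k : Fin 2 → ℤ), Real.pi_pos, sq_nonneg Real.pi, mul_nonneg hm.le h1]
  -- STEP 1: a good time `s_n ∈ (0,1)` with `Z n s_n ≤ C₁ + 1`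
  have hgood : ∀ n, ∃ s ∈ Ioo (0 : ℝ) 1, Z n s ≤ K₁ := by
    intro n
    by_contra hcon
    push Not at hcon
    have hdiss := hScheme.lintegral_eGradNormSq_le hν hu₀ one_pos hA n (hFA n)
    have hlow : ENNReal.ofReal K₁ * volume (Ioo (0 : ℝ) 1) ≤ ∫⁻ t in Ioo 0 1, eGradNormSq (U n t) := by
      rw [← setLIntegral_const]
      refine setLIntegral_mono' measurableSet_Ioo fun t ht => ?_
      rw [hZ_eGrad]
      exact ENNReal.ofReal_le_ofReal (hcon t ht).le
    rw [Real.volume_Ioo, sub_zero, ENNReal.ofReal_one, mul_one] at hlow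
    have h := hlow.trans hdiss
    rw [ENNReal.ofReal_le_ofReal_iff hC₁0] at h
    simp only [hK₁] at h
    linarith
  choose sgood hsgood_mem hsgood using hgood
  -- STEP 2: the decaying bound on the signed excess for `t ≥ 1`
  have hξ_bound : ∀ n t, 1 ≤ t → ξ n t ≤ K₁ * Real.exp (-cc * (t - 1)) := by
    intro n t ht
    have hs0 : 0 ≤ sgood n := (hsgood_mem n).1.le
    have hs1 : sgood n ≤ 1 := (hsgood_mem n).2.le
    have hdecay := galerkin_shellExcess_le_mul_exp hν.le (hS n) (hβmem n) (hβderiv n) m (hg1' n) hs0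
      (hs1.trans ht)
    have hexp1 : Real.exp (-(8 * Real.pi ^ 2 * m * ν) * (t - sgood n)) ≤ Real.exp (-cc * (t - 1)) := by
      refine Real.exp_le_exp.2 ?_
      simp only [hcc]
      nlinarith
    have hexp0 : 0 ≤ Real.exp (-(8 * Real.pi ^ 2 * m * ν) * (t - sgood n)) := (Real.exp_pos _).le
    rcases le_or_gt 0 (ξ n (sgood n)) with hpos | hneg
    · calc ξ n t ≤ ξ n (sgood n) * Real.exp (-(8 * Real.pi ^ 2 * m * ν) * (t - sgood n)) := hdecay
        _ ≤ K₁ * Real.exp (-cc * (t - 1)) := by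
            refine mul_le_mul ((hξ_le_Z n _).trans (hsgood n)) hexp1 hexp0 hK₁0
    · calc ξ n t ≤ ξ n (sgood n) * Real.exp (-(8 * Real.pi ^ 2 * m * ν) * (t - sgood n)) := hdecay
        _ ≤ 0 := mul_nonpos_of_nonpos_of_nonneg hneg.le hexp0
        _ ≤ K₁ * Real.exp (-cc * (t - 1)) := by positivity
  -- STEP 3: the same bound for the clipped series of the Galerkin states, in `ℝ≥0∞`
  have hPlus_le : ∀ n t, 1 ≤ t →
      (∑' k : Fin 2 → ℤ, ENNReal.ofReal (4 * Real.pi ^ 2 * (freqNormSq k - m)) *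
          ‖mFourierCoeff (EuclideanSpace.complexify ∘ U n t) k‖ₑ ^ 2) ≤
        (∑' k : Fin 2 → ℤ, ENNReal.ofReal (4 * Real.pi ^ 2 * (m - freqNormSq k)) *
          ‖mFourierCoeff (EuclideanSpace.complexify ∘ U n t) k‖ₑ ^ 2) +
          ENNReal.ofReal (K₁ * Real.exp (-cc * (t - 1))) := by
    intro n t ht
    simp_rw [hcoefU]
    have hid := galerkin_shellExcess_eq_toReal_sub_toReal m (β n t)
    have hb := hξ_bound n t ht
    simp only [hξ] at hb
    rw [hid] at hb
    -- both clipped sums are finite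
    have hfinP : (∑' k : Fin 2 → ℤ, ENNReal.ofReal (4 * Real.pi ^ 2 * (freqNormSq k - m)) *
        ‖coeffExt (S n) (β n t) k‖ₑ ^ 2) ≠ ⊤ := by
      rw [tsum_ofReal_mul_enorm_sq_coeffExt]
      exact ENNReal.sum_ne_top.2 fun k _ => ENNReal.mul_ne_top ENNReal.ofReal_ne_top (ENNReal.pow_ne_top enorm_ne_top)
    have hfinM : (∑' k : Fin 2 → ℤ, ENNReal.ofReal (4 * Real.pi ^ 2 * (m - freqNormSq k)) *
        ‖coeffExt (S n) (β n t) k‖ₑ ^ 2) ≠ ⊤ := by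
      rw [tsum_ofReal_mul_enorm_sq_coeffExt]
      exact ENNReal.sum_ne_top.2 fun k _ => ENNReal.mul_ne_top ENNReal.ofReal_ne_top (ENNReal.pow_ne_top enorm_ne_top)
    have hK0 : 0 ≤ K₁ * Real.exp (-cc * (t - 1)) := by positivity
    rw [← ENNReal.ofReal_toReal hfinP, ← ENNReal.ofReal_toReal hfinM, ← ENNReal.ofReal_add ENNReal.toReal_nonneg hK0]
    exact ENNReal.ofReal_le_ofReal (by linarith)
  -- the limit field and the global Leray–Hopf solution
  obtain ⟨φ, hφ, u, hum, hu, hc⟩ := hScheme.exists_limitField hν.le hu₀ hfm hf₂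
  have hLH : IsGlobalLerayHopf ν (fun _ => f) u₀ u := fun T hT =>
    (hScheme.comp_strictMono hφ).isLerayHopfOn_limit hν hu₀ hdiv hfm hf₂ hum hu hc hT
  refine ⟨u, hLH, K₁, hK₁0, fun t ht => ?_⟩
  have ht0 : 0 ≤ t := zero_le_one.trans ht
  -- STEP 4: Fatou for `Φ⁺`, continuity for `Φ⁻`
  have hPlus := shellPlus_le_liminf m (U := fun j => U (φ j)) hc ht0
  have hMinus := tendsto_shellMinus m (U := fun j => U (φ j)) hc ht0
  have hlim : liminf (fun j => ∑' k : Fin 2 → ℤ, ENNReal.ofReal (4 * Real.pi ^ 2 * (freqNormSq k - m)) *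
      ‖mFourierCoeff (EuclideanSpace.complexify ∘ U (φ j) t) k‖ₑ ^ 2) atTop ≤
      (∑' k : Fin 2 → ℤ, ENNReal.ofReal (4 * Real.pi ^ 2 * (m - freqNormSq k)) *
        ‖mFourierCoeff (EuclideanSpace.complexify ∘ u t) k‖ₑ ^ 2) +
        ENNReal.ofReal (K₁ * Real.exp (-cc * (t - 1))) := by
    have h2 : Tendsto (fun j => (∑' k : Fin 2 → ℤ, ENNReal.ofReal (4 * Real.pi ^ 2 * (m - freqNormSq k)) *
        ‖mFourierCoeff (EuclideanSpace.complexify ∘ U (φ j) t) k‖ₑ ^ 2) +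
        ENNReal.ofReal (K₁ * Real.exp (-cc * (t - 1)))) atTop
        (𝓝 ((∑' k : Fin 2 → ℤ, ENNReal.ofReal (4 * Real.pi ^ 2 * (m - freqNormSq k)) *
          ‖mFourierCoeff (EuclideanSpace.complexify ∘ u t) k‖ₑ ^ 2) +
          ENNReal.ofReal (K₁ * Real.exp (-cc * (t - 1))))) := hMinus.add tendsto_const_nhds
    rw [← h2.liminf_eq]
    exact liminf_le_liminf (Eventually.of_forall fun j => hPlus_le (φ j) t ht)
  have hkey := hPlus.trans hlim
  -- STEP 5: the spectral identity turns the bound into `‖∇u(t)‖² ≤ Λ‖u(t)‖² + K e^{-c(t-1)}`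
  have hfinal := eGradNormSq_le_of_shellPlus_le m hm.le (hu t ht0) (by positivity) hkey
  simpa only [hcc] using hfinal

end PincerGalerkin

end Summit.AnomalousDissipation.AnomalousDissipation.Theorems.TwodBoundedEnergyZeroMomentum.Negative

end
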